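import Literature.Computability.Complexity.GraphCanonizationProgramFPFrames
import HarnessLib

/-!
# The canoniser as a list program is typed polynomial time, V: starting frames, least candidates, pasting

`CodeFP` certificates for the three frame-producing ingredients of the machine transition
(`GraphCanonizationProgramMachine.lean`): **`codeFP_classifyL`** (the starting frame of a state,
built as a tagged record and re-read as the code of a frame, `frameE_*`), **`codeFP_bestOfT`**
(keeping the least candidate, on candidate data, `leCandB`), **`codeFP_pasteL`** (sorting the
finished parts by key with `CodeFP.insertionSortCtx` and the key test `lePKeyB`, then
concatenating the orderings).

## References

* S. Arora, B. Barak, *Computational Complexity: A Modern Approach*, CUP 2009, §1.3. [AroraBarakCC2009]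
* B. Laubner, PhD thesis, HU Berlin 2011, doi:10.18452/16335, §3.4. [Laubner2011]
-/

namespace Literature.Computability.Complexity

open _root_.Computability CodeFP Polynomial CGCanon

namespace CGProg

/-! ### Starting frames -/

/-- The input of `classifyL`: `((1ⁿ, rows), (mask, colours))`. [folklore] -/
abbrev ClsIn : Type := (ℕ × List (List Bool)) × (List Bool × List ℕ)

/-- Its code. [folklore] -/
abbrev clsInE : ClsIn → List Bool := pairE (pairE unE (rawE strE)) (pairE strE (rawE natE))

/-- The refinement context of a `classifyL` input. [folklore] -/
theorem codeFP_clsCtx : CodeFP clsInE ctxE (fun p => ((p.1.1, (p.1.2, p.2.1)), p.2.2)) :=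
  ((fst _ _).fst'.pair ((fst _ _).snd'.pair (snd _ _).fst')).pair (snd _ _).snd'

/-- The record of `ret ord` from a computed `ord`. [folklore] -/
theorem codeFP_retRecord {α : Type} {eα : α → List Bool} {g : α → List ℕ} (hg : CodeFP eα (rawE natE) g) :
    CodeFP eα frameE (fun a => LFrame.ret (g a)) := by
  have h : CodeFP eα ftupleE (fun a => ((2 : ℕ), ([] : List Bool), ([] : List ℕ), (none : Option ℕ), ([] : List ℕ), (none : Option LCandT),
      (none : Option (List Bool)), ([] : List (List Bool)), ([] : List (List Bool × List ℕ)), g a)) :=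
    (const _ 2).pair ((const _ []).pair ((const _ []).pair ((const _ none).pair ((const _ []).pair ((const _ none).pair
      ((const _ none).pair ((const _ []).pair ((const _ []).pair hg))))))))
  exact h.recodeOut fun a => (frameE_ret (g a)).symm

/-- The record of `indiv mask col none xs none`. [folklore] -/
theorem codeFP_indivRecord {α : Type} {eα : α → List Bool} {m : α → List Bool} {c xs : α → List ℕ}
    (hm : CodeFP eα strE m) (hc : CodeFP eα (rawE natE) c) (hxs : CodeFP eα (rawE natE) xs) :
    CodeFP eα frameE (fun a => LFrame.indiv (m a) (c a) none (xs a) none) := by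
  have h : CodeFP eα ftupleE (fun a => ((0 : ℕ), m a, c a, (none : Option ℕ), xs a, (none : Option LCandT),
      (none : Option (List Bool)), ([] : List (List Bool)), ([] : List (List Bool × List ℕ)), ([] : List ℕ))) :=
    (const _ 0).pair (hm.pair (hc.pair ((const _ none).pair (hxs.pair ((const _ none).pair
      ((const _ none).pair ((const _ []).pair ((const _ []).pair (const _ [])))))))))
  exact h.recodeOut fun a => (frameE_indiv (m a) (c a) none (xs a) none).symm

/-- The record of `sect mask col none todo []`. [folklore] -/
theorem codeFP_sectRecord {α : Type} {eα : α → List Bool} {m : α → List Bool} {c : α → List ℕ} {todo : α → List (List Bool)}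
    (hm : CodeFP eα strE m) (hc : CodeFP eα (rawE natE) c) (ht : CodeFP eα (rawE strE) todo) :
    CodeFP eα frameE (fun a => LFrame.sect (m a) (c a) none (todo a) []) := by
  have h : CodeFP eα ftupleE (fun a => ((1 : ℕ), m a, c a, (none : Option ℕ), ([] : List ℕ), (none : Option LCandT),
      (none : Option (List Bool)), todo a, ([] : List (List Bool × List ℕ)), ([] : List ℕ))) :=
    (const _ 1).pair (hm.pair (hc.pair ((const _ none).pair ((const _ []).pair ((const _ none).pair
      ((const _ none).pair (ht.pair ((const _ []).pair (const _ [])))))))))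
  exact h.recodeOut fun a => (frameE_sect (m a) (c a) none (todo a) []).symm

/-- **The starting frame of a state is typed polynomial time.** [cite: Laubner2011, §3.4 steps 1–3] -/
theorem codeFP_classifyL : CodeFP clsInE frameE (fun p => classifyL p.1.1 p.1.2 p.2.1 p.2.2) := by
  have hm : CodeFP clsInE strE (fun p => p.2.1) := (snd _ _).fst'
  have hc : CodeFP clsInE (rawE natE) (fun p => p.2.2) := (snd _ _).snd'
  have hw : CodeFP clsInE (rawE natE) (fun p => wlistL p.2.1) := codeFP_wlistL.comp hm
  have hsmall : CodeFP clsInE bitE (fun p => decide ((wlistL p.2.1).length ≤ 1)) := natLe.comp (((natLength natE).comp hw).pair (const _ 1))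
  have hconn : CodeFP clsInE bitE (fun p => isConnL p.1.1 p.1.2 p.2.1 p.2.2) := (codeFP_isConnL.comp codeFP_clsCtx).congr fun _ => rfl
  have hbig : CodeFP clsInE (rawE natE) (fun p => bigMinCellL p.2.1 p.2.2) := codeFP_bigMinCellL.comp (snd _ _)
  have hbigE : CodeFP clsInE bitE (fun p => (bigMinCellL p.2.1 p.2.2).isEmpty) := (rawIsEmpty natE).comp hbig
  have hparts : CodeFP clsInE (rawE strE) (fun p => partsL p.1.1 p.1.2 p.2.1 p.2.2) := (codeFP_partsL.comp codeFP_clsCtx).congr fun _ => rfl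
  have hret : CodeFP clsInE frameE (fun p => LFrame.ret (wlistL p.2.1)) := codeFP_retRecord hw
  have hindiv : CodeFP clsInE frameE (fun p => LFrame.indiv p.2.1 p.2.2 none (bigMinCellL p.2.1 p.2.2) none) := codeFP_indivRecord hm hc hbig
  have hsect : CodeFP clsInE frameE (fun p => LFrame.sect p.2.1 p.2.2 none (partsL p.1.1 p.1.2 p.2.1 p.2.2) []) := codeFP_sectRecord hm hc hparts
  refine (hsmall.ite hret (hconn.ite (hbigE.ite hret hindiv) hsect)).congr fun p => ?_
  unfold classifyL
  by_cases h1 : (wlistL p.2.1).length ≤ 1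
  · simp [h1]
  · by_cases h2 : isConnL p.1.1 p.1.2 p.2.1 p.2.2 = true
    · by_cases h3 : bigMinCellL p.2.1 p.2.2 = []
      · simp [h1, h2, h3]
      · simp [h1, h2, h3, List.isEmpty_eq_false_iff.2 h3]
    · simp [h1, h2]

/-! ### Least candidates on data -/

/-- Keeping the least candidate, on candidate data. [folklore] -/
def bestOfT (o : Option LCandT) (b : LCandT) : Option LCandT := some (o.elim b fun a => if leCandB a b then a else b)

/-- `bestOfT` is `bestOfL` on data. [folklore] -/
theorem bestOfT_eq (o : Option LCand) (b : LCand) : bestOfT (o.map dataOfCand) (dataOfCand b) = (bestOfL o b).map dataOfCand := by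
  cases o with
  | none => rfl
  | some a =>
    simp only [bestOfT, bestOfL, Option.map_some, Option.elim, leCandB_eq, candOfT_dataOfCand, min_def, decide_eq_true_eq]
    split_ifs <;> rfl

/-- **Keeping the least candidate is typed polynomial time**: input `(best so far, new candidate)`. [cite: AroraBarakCC2009, §1.3] -/
theorem codeFP_bestOfT : CodeFP (pairE (optE candTE) candTE) (optE candTE) (fun p => bestOfT p.1 p.2) := by
  have hsome : CodeFP (pairE candTE candTE) candTE (fun t => if leCandB t.2 t.1 then t.2 else t.1) :=
    (codeFP_leCandB.comp ((snd _ _).pair (fst _ _))).ite (snd _ _) (fst _ _)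
  have h := optCases (σ := LCandT) (α := LCandT) (eσ := candTE) (eα := candTE) (eδ := candTE)
    (k := fun b o => o.elim b fun a => if leCandB a b then a else b) (gnone := fun b => b) (gsome := fun t => if leCandB t.2 t.1 then t.2 else t.1)
    (CodeFP.id _) hsome (fun _ => rfl) (fun _ _ => rfl)
  exact ((optSome candTE).comp (h.comp ((snd _ _).pair (fst _ _)))).congr fun _ => rfl

/-! ### Pasting -/

/-- The key data of a finished part. [folklore] -/
def pkeyDataL (A : List (List Bool)) (col : List ℕ) (p : List Bool × List ℕ) : PKeyT := (codeL A col p.2, wlistL p.1)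

/-- Its key. [folklore] -/
theorem pkeyOfT_pkeyDataL (A : List (List Bool)) (col : List ℕ) (p : List Bool × List ℕ) : pkeyOfT (pkeyDataL A col p) = pkeyL A col p := rfl

/-- The key data are typed polynomial time: input `((rows, colours), part)`. [folklore] -/
theorem codeFP_pkeyDataL : CodeFP (pairE (pairE (rawE strE) (rawE natE)) (pairE strE (rawE natE))) pkeyTE (fun t => pkeyDataL t.1.1 t.1.2 t.2) :=
  ((codeFP_codeL.comp ((fst _ _).pair (snd _ _).snd')).pair (codeFP_wlistL.comp (snd _ _).fst')).congr fun _ => rfl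

/-- **Pasting the finished parts is typed polynomial time**: input `((rows, colours), done)`. [cite: Laubner2011, Thm. 3.4.3] -/
theorem codeFP_pasteL : CodeFP (pairE (pairE (rawE strE) (rawE natE)) (rawE (pairE strE (rawE natE)))) (rawE natE) (fun p => pasteL p.1.1 p.1.2 p.2) := by
  let σE : List (List Bool) × List ℕ → List Bool := pairE (rawE strE) (rawE natE)
  let ιE : List Bool × List ℕ → List Bool := pairE strE (rawE natE)
  have hka : CodeFP (pairE σE (pairE ιE ιE)) pkeyTE (fun t => pkeyDataL t.1.1 t.1.2 t.2.1) := (codeFP_pkeyDataL.comp ((fst _ _).pair (snd _ _).fst')).congr fun _ => rfl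
  have hkb : CodeFP (pairE σE (pairE ιE ιE)) pkeyTE (fun t => pkeyDataL t.1.1 t.1.2 t.2.2) := (codeFP_pkeyDataL.comp ((fst _ _).pair (snd _ _).snd')).congr fun _ => rfl
  have hr : CodeFP (pairE σE (pairE ιE ιE)) bitE (fun t => decide (pkeyL t.1.1 t.1.2 t.2.1 ≤ pkeyL t.1.1 t.1.2 t.2.2)) :=
    (codeFP_lePKeyB.comp (hka.pair hkb)).congr fun t => by rw [lePKeyB_eq]; exact decide_eq_decide.2 Iff.rfl
  have hsort := insertionSortCtx (σ := List (List Bool) × List ℕ) (α := List Bool × List ℕ) (eσ := σE) (eα := ιE)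
    (r := fun s a b => pkeyL s.1 s.2 a ≤ pkeyL s.1 s.2 b) hr
  have hflat : CodeFP (rawE ιE) (rawE natE) (fun l => l.flatMap Prod.snd) :=
    ((flatten natE).comp (map₀ (snd strE (rawE natE)))).congr fun l => by rw [List.flatMap_def]
  exact (hflat.comp hsort).congr fun _ => rfl

end CGProg

end Literature.Computability.Complexity
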